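import Literature.Geometry.Manifold.DiscSubmersionLevels
import Literature.Geometry.Symplectic.PlanarHomologySphereFillingsPALF
import HarnessLib

/-!
# The boundary levels of a Lefschetz fibration over the disc: all homeomorphic to the binding

Topic `Literature/Geometry/Symplectic` (fact seat
`provefact-Literature.Geometry.Symplectic.Oba2016_s-add47373d4`; first brick of the fibre-page
statement `hF` of `kasHandleCount_of_planarFibreMorse`, Kas 1980 §2 / Gompf–Stipsicz 1999
§8.2: the boundary `∂F(c₀) = F(c₀) ∩ ∂W` of the regular fibre of a PALF has as many components
as the binding).  For a PALF `P` on `W` with boundary datum `b` (`Literature.Geometry.Symplectic.PALF`) the boundary map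
`g = f ∘ b.incl : ∂W → ℝ²` is a submersion over the open unit disc
(`PALF.boundary_submersion`) on the closed 3-manifold `b.carrier ≅ ∂W`, and its level over `0`
is the binding (`PALF.mem_binding_iff`); by
`Literature.Geometry.Manifold.nonempty_homeomorph_level_of_norm_lt_one` all its levels over the
open disc are homeomorphic:

* `PALF.nonempty_homeomorph_boundaryLevel_binding` — `{y ∈ ∂W | f y = c₀} ≃ₜ B` for `‖c₀‖ < 1`;
* `PALF.natCard_connectedComponents_boundaryLevel` — hence they have equally many connected
  components.

Everything is proved; no definitions, no named facts.

## References

* A. Kas, *On the handlebody decomposition associated to a Lefschetz fibration*, Pacific J.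
  Math. 89 (1980), §2. [Kas1980]
* R. E. Gompf, A. I. Stipsicz, *4-Manifolds and Kirby Calculus*, GSM 20 (1999), §8.2.
  [GompfStipsiczGSM1999]
* M. W. Hirsch, *Differential Topology*, GTM 33 (1976), Ch. 6 §2, Thm. 2.2. [HirschDT1976]
-/

open scoped Manifold ContDiff Topology
open Set Function Filter

noncomputable section

namespace Literature.Geometry.Symplectic

open Literature.Topology.FourManifolds Literature.Geometry.Manifold

universe u

variable {W : Type u} [TopologicalSpace W] [T2Space W] [SecondCountableTopology W]
  [ChartedSpace (EuclideanHalfSpace 4) W] [IsManifold (𝓡∂ 4) ∞ W] [CompactSpace W]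
  {o : SmoothOrientation (𝓡∂ 4) W} {b : BoundaryData (𝓡∂ 4) W (𝓡 3)}

namespace PALF

/-- **The boundary levels of a PALF over the open disc are homeomorphic to the binding**: for
`‖c₀‖ < 1`, `{y ∈ ∂W | f y = c₀} ≃ₜ B` (Ehresmann for the boundary submersion `f|_{∂W}` over the
open disc, Hirsch 1976 Ch. 6 §2 Thm. 2.2; `B = ∂W ∩ f⁻¹(0)`). [cite: Kas1980, §2]
[cite: HirschDT1976, Ch. 6 §2, Thm. 2.2 (PDF p. 144)] -/
theorem nonempty_homeomorph_boundaryLevel_binding (P : PALF o b) {c₀ : EuclideanSpace ℝ (Fin 2)}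
    (hc₀ : ‖c₀‖ < 1) :
    Nonempty ({y : b.carrier // P.f (b.incl y) = c₀} ≃ₜ P.ob.binding) := by
  haveI : CompactSpace b.carrier := b.compactSpace_carrier
  haveI : T2Space b.carrier := b.isSmoothEmbedding.isEmbedding.t2Space
  haveI : SecondCountableTopology b.carrier := b.isSmoothEmbedding.isEmbedding.secondCountableTopology
  have hg : ContMDiff (𝓡 3) 𝓘(ℝ, EuclideanSpace ℝ (Fin 2)) ∞ (P.f ∘ b.incl) :=
    P.contMDiff.comp b.isSmoothEmbedding.contMDiff
  have hsub : ∀ y : b.carrier, ‖(P.f ∘ b.incl) y‖ < 1 →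
      Surjective (mfderiv (𝓡 3) 𝓘(ℝ, EuclideanSpace ℝ (Fin 2)) (P.f ∘ b.incl) y) :=
    fun y hy => P.boundary_submersion y hy
  obtain ⟨e⟩ := nonempty_homeomorph_level_of_norm_lt_one (I := 𝓡 3) hg hsub hc₀
    (c₁ := (0 : EuclideanSpace ℝ (Fin 2))) (by simp)
  have hset : {y : b.carrier | (P.f ∘ b.incl) y = 0} = P.ob.binding := by
    ext y
    exact (P.mem_binding_iff y).symm
  exact ⟨e.trans (Homeomorph.setCongr hset)⟩

/-- **The boundary level `{y ∈ ∂W | f y = c₀}`, `‖c₀‖ < 1`, has as many connected components as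
the binding.** [cite: Kas1980, §2] -/
theorem natCard_connectedComponents_boundaryLevel (P : PALF o b) {c₀ : EuclideanSpace ℝ (Fin 2)}
    (hc₀ : ‖c₀‖ < 1) :
    Nat.card (ConnectedComponents {y : b.carrier // P.f (b.incl y) = c₀}) =
      Nat.card (ConnectedComponents P.ob.binding) := by
  obtain ⟨e⟩ := P.nonempty_homeomorph_boundaryLevel_binding hc₀
  exact natCard_connectedComponents_congr e

end PALF

end Literature.Geometry.Symplectic

end
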